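import Summits.BirchSwinnertonDyer.BirchSwinnertonDyer.Theorems.Rank1ResidualJetGlobalDuality
import HarnessLib

/-!
# T1 JET (cell `bsd-jet`), road K: Poitou–Tate counting for Selmer structures that differ at
# FINITELY MANY PRESCRIBED finite places — `∏` over those places only; the ONE-PLACE form
# `[H¹_𝓖 : H¹_{𝓖[v₀ ↦ L₀]}] · [H¹_{𝓖[v₀ ↦ L₀]^*} : H¹_{𝓖^*}] = [𝓖_{v₀} : L₀]`

HONEST FRAMING (programme file `BSD-LIT2PART-PROGRAMME-v1.md` §HONESTY, verbatim): «no tranche here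
proves BSD; ARM L moves the LITERAL column of an r ≤ 1 census into the kernel-proved-modulo-named-print
column; ARM P changes what «named print» is worth.» THEOREMS ONLY (seat `bsd-jet-pv-1`, session g3;
`--supports stmt-BirchSwinnertonDyer-14418`, helper): no definition, no named fact, no `sorry`.
Nothing is booked; 0 classes move. GENERIC Galois cohomology: no elliptic curve, no `p`-versus-`N`.

## Why (the two shapes in which Jetchev 2008 uses Thm. 5.1; sheet `HOME/sheets/PV2-J6-KERNEL.md` §2)

The counting form of Poitou–Tate duality for Selmer structures is the tree's
`GlobalDuality.relIndex_selmerGroup_mul_relIndex_dualSelmerGroup` (`Rank1ResidualJetGlobalDuality.lean`,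
p479216): `[H¹_𝓖 : H¹_𝓕] · [H¹_{𝓕^*} : H¹_{𝓖^*}] = ∏_{v ∈ T} [𝓖_v : 𝓕_v]`, the product running over
ALL finite places `T` of the set `S` outside which the structures are unramified. In Jetchev's proof
of Thm. 6.3 (p. 823) the two structures compared differ at prescribed places only — `𝓕₀ = 𝓕_⌈q⌉ ≼ 𝓕`
at the two places `v, v̄ ∣ q` (Def. 4.8: «in the same way as `𝓕` except that for each places `v ∣ q_i`
… the local condition at `v` is replaced by the stringent Kummer condition»), and `𝓕₀(c) ≼ (𝓕₀)^ℓ(c)`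
at the one place `λ ∣ ℓ` (§4.3 item 3, «simply replacing them at the places `v ∣ abc`»; Lemma 5.2).
This file records the corresponding corollaries, so that an instantiation (stubs S2/S3 of the line)
only has to name the modified places:

* `relIndex_selmerGroup_mul_relIndex_dualSelmerGroup_of_eq_off` — if `𝓕_v = 𝓖_v` at every finite
  place outside `T₀ ⊆ T`, the product is `∏_{v ∈ T₀} [𝓖_v : 𝓕_v]`;
* `relIndex_selmerGroup_mul_relIndex_dualSelmerGroup_update` — **one place**: for `v₀ ∈ T` and a
  smaller local condition `L₀ ≤ 𝓖_{v₀}`, the structure `𝓖[v₀ ↦ L₀]` (`Function.update`, no definition)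
  satisfies `[H¹_𝓖 : H¹_{𝓖[v₀ ↦ L₀]}] · [H¹_{𝓖[v₀ ↦ L₀]^*} : H¹_{𝓖^*}] = [𝓖_{v₀} : L₀]` — the TOTAL
  (both-signs) form of Lemma 5.2 (iii) `a + a^* = m` (relaxing ∕ restricting at `λ`) and, applied
  twice, of the carrier comparison at `v, v̄ ∣ q`.

References (locators only; no cited FACT is declared): [cite: Jetchev2008, Def. 4.8 (p. 821), §4.3
item 3, Thm. 5.1 and Lemma 5.2 (p. 822), proof of Thm. 6.3 (p. 823)]
[cite: Howard2004HeegnerKolyvagin, Thm. 2.1.11 (arXiv:1202.6340 p. 6)].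
Design: no definitions; universe `u` for `K`, `M` as in `PoitouTate.lean`. Axioms: `propext`,
`Classical.choice`, `Quot.sound`.
-/

set_option autoImplicit false

noncomputable section

open scoped Classical
open Function NumberField IsDedekindDomain
open Literature.NumberTheory.GaloisRepresentations

universe u

namespace Summit.BirchSwinnertonDyer.Rank1Residual.JET.GlobalDuality

section OnePlace

open Literature.NumberTheory.GaloisCohomology
open Literature.NumberTheory.GaloisRepresentations.DiscreteGaloisModule (localTatePairingZMod
  tateDual SelmerStructure)

variable {K : Type u} [Field K] [NumberField K] {n : ℕ} [NeZero n] {M : Type u} [AddCommGroup M]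
  [TopologicalSpace M] [DiscreteTopology M] [Finite M] {ρ : DiscreteGaloisModule K M}

/-- **Poitou–Tate counting for structures that agree off `T₀`.** Under the hypotheses of
`relIndex_selmerGroup_mul_relIndex_dualSelmerGroup`, if `𝓕_v = 𝓖_v` at every finite place of `T`
outside `T₀ ⊆ T`, then `[H¹_𝓖 : H¹_𝓕] · [H¹_{𝓕^*} : H¹_{𝓖^*}] = ∏_{v ∈ T₀} [𝓖_v : 𝓕_v]`.
[cite: Jetchev2008, §4.3 item 3 and Thm. 5.1 (pp. 821–822)] -/
theorem relIndex_selmerGroup_mul_relIndex_dualSelmerGroup_of_eq_off (inv : LocalInvariants K n)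
    (hperf : inv.IsPerfect) (hvan : inv.SumLocalTermEqZero) (hSC : inv.SelmerComplement)
    (hM : ∀ m : M, n • m = 0)
    (S : Finset (Place K)) (T : Finset (HeightOneSpectrum (𝓞 K)))
    (hT : ∀ v, (Sum.inr v : Place K) ∈ S ↔ v ∈ T)
    (hS : ∀ v : HeightOneSpectrum (𝓞 K), (Sum.inr v : Place K) ∉ S →
      ((n : ℕ) : 𝓞 K) ∉ v.asIdeal ∧ GaloisRep.IsUnramifiedAt v ρ)
    {𝓕 𝓖 : SelmerStructure ρ} (hle : 𝓕 ≤ 𝓖) (h𝓕 : 𝓕.IsUnramifiedOutside S)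
    (h𝓖 : 𝓖.IsUnramifiedOutside S)
    (hinf : ∀ w : InfinitePlace K, 𝓕 (Sum.inl w) = 𝓖 (Sum.inl w))
    (T₀ : Finset (HeightOneSpectrum (𝓞 K))) (hT₀ : T₀ ⊆ T)
    (hoff : ∀ v ∈ T, v ∉ T₀ → 𝓕 (Sum.inr v) = 𝓖 (Sum.inr v)) :
    𝓕.selmerGroup.relIndex 𝓖.selmerGroup *
        (inv.dualSelmerStructure ρ 𝓖).selmerGroup.relIndex
          (inv.dualSelmerStructure ρ 𝓕).selmerGroup =
      ∏ v ∈ T₀, (𝓕 (Sum.inr v)).relIndex (𝓖 (Sum.inr v)) := by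
  rw [relIndex_selmerGroup_mul_relIndex_dualSelmerGroup inv hperf hvan hSC hM S T hT hS hle h𝓕 h𝓖
    hinf]
  refine (Finset.prod_subset hT₀ fun v hv hv₀ => ?_).symm
  rw [hoff v hv hv₀, AddSubgroup.relIndex_self]

/-- **Poitou–Tate counting, ONE PLACE.** Let `𝓖` be a Selmer structure unramified outside `S`,
`v₀` a finite place of `S` and `L₀ ≤ 𝓖_{v₀}` a smaller local condition; `𝓖[v₀ ↦ L₀]` the structure
with the condition at `v₀` replaced. Then
`[H¹_𝓖 : H¹_{𝓖[v₀ ↦ L₀]}] · [H¹_{𝓖[v₀ ↦ L₀]^*} : H¹_{𝓖^*}] = [𝓖_{v₀} : L₀]` — the total form of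
Jetchev's Lemma 5.2 (iii) (`𝓕(c) ≼ 𝓕^ℓ(c)` at `λ`) and of the stringent comparison at one place.
[cite: Jetchev2008, Lemma 5.2 (iii) (p. 822), Def. 4.8 (p. 821)] -/
theorem relIndex_selmerGroup_mul_relIndex_dualSelmerGroup_update (inv : LocalInvariants K n)
    (hperf : inv.IsPerfect) (hvan : inv.SumLocalTermEqZero) (hSC : inv.SelmerComplement)
    (hM : ∀ m : M, n • m = 0)
    (S : Finset (Place K)) (T : Finset (HeightOneSpectrum (𝓞 K)))
    (hT : ∀ v, (Sum.inr v : Place K) ∈ S ↔ v ∈ T)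
    (hS : ∀ v : HeightOneSpectrum (𝓞 K), (Sum.inr v : Place K) ∉ S →
      ((n : ℕ) : 𝓞 K) ∉ v.asIdeal ∧ GaloisRep.IsUnramifiedAt v ρ)
    (𝓖 : SelmerStructure ρ) (h𝓖 : 𝓖.IsUnramifiedOutside S)
    (v₀ : HeightOneSpectrum (𝓞 K)) (hv₀ : v₀ ∈ T)
    (L₀ : AddSubgroup (galoisCohomology (ρ.toLocal (Sum.inr v₀)) 1)) (hL₀ : L₀ ≤ 𝓖 (Sum.inr v₀)) :
    (SelmerStructure.selmerGroup (Function.update 𝓖 (Sum.inr v₀) L₀)).relIndex 𝓖.selmerGroup *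
        (inv.dualSelmerStructure ρ 𝓖).selmerGroup.relIndex
          (inv.dualSelmerStructure ρ (Function.update 𝓖 (Sum.inr v₀) L₀)).selmerGroup =
      L₀.relIndex (𝓖 (Sum.inr v₀)) := by
  set 𝓕 : SelmerStructure ρ := Function.update 𝓖 (Sum.inr v₀) L₀ with h𝓕def
  have h𝓕v₀ : 𝓕 (Sum.inr v₀) = L₀ := by rw [h𝓕def, Function.update_self]
  have h𝓕ne : ∀ v, v ≠ Sum.inr v₀ → 𝓕 v = 𝓖 v := fun v hv => by
    rw [h𝓕def, Function.update_of_ne hv]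
  have hle : 𝓕 ≤ 𝓖 := fun v => by
    by_cases hv : v = Sum.inr v₀
    · subst hv; rw [h𝓕v₀]; exact hL₀
    · rw [h𝓕ne v hv]
  have hv₀S : (Sum.inr v₀ : Place K) ∈ S := (hT v₀).mpr hv₀
  have h𝓕 : 𝓕.IsUnramifiedOutside S :=
    ⟨h𝓖.1, fun v hv => by
      rw [h𝓕ne _ fun h => hv (by rw [h]; exact hv₀S)]
      exact h𝓖.2 v hv⟩
  have hinf : ∀ w : InfinitePlace K, 𝓕 (Sum.inl w) = 𝓖 (Sum.inl w) :=
    fun w => h𝓕ne _ Sum.inl_ne_inr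
  rw [relIndex_selmerGroup_mul_relIndex_dualSelmerGroup_of_eq_off inv hperf hvan hSC hM S T hT hS hle
    h𝓕 h𝓖 hinf {v₀} (Finset.singleton_subset_iff.mpr hv₀)
    (fun v _ hv => h𝓕ne _ fun h => hv (Finset.mem_singleton.mpr (Sum.inr_injective h))),
    Finset.prod_singleton, h𝓕v₀]

end OnePlace

end Summit.BirchSwinnertonDyer.Rank1Residual.JET.GlobalDuality

end
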